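import Mathlib
import HarnessLib

/-!
# The coherent double is the polar curve of the theta divisor; the hexagon is `Θ_u ∩ Θ_v`
# (WEIL-2 gen 30, ANCHOR-G30 §2, fact-free algebraic core)

research route, not a corollary; conditional on HC_CM plus one named minimal statement.

Cell `pub-hodge-ring2-ab-*` (ALL ABELIAN VARIETIES), seat WEIL-2 gen 30, account
`run/shared/lean/pub/pub-hodge-ring2/pub-hodge-ring2-ab-weil-2/ANCHOR-G30.md` §2 (LEMMA Θ, LEMMA P, LEMMA N).

Informal setting (not formalised).  `X₀ = E₁ × E₂ × E₃` with theta divisor `Θ = D₁ + D₂ + D₃`, locally `ϑ = xyz` at the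
triple point of `T` = the three axes; `Θ_t` = the translate, locally `(x − t₁)(y − t₂)(z − t₃)`.  ANCHOR-G30 §2 identifies the two
«6/6» objects of gens 27–29 with complete intersections of theta translates:
* the HEXAGON of habitat1 / CONE-G29 5.11 (six translated axes, six nodes) is `Θ_u ∩ Θ_v` (`u_a ≠ v_a`); in the normalisation
  `u = s(0,0,b)`, `v = s(g,a,0)` it is the Petrie hexagon of the box `[0,gs]×[0,as]×[0,bs]`: the six lines
  `L₁ = (x,0,0)`, `L₂ = (0,y,0)`, `L₃ = (0,as,z)`, `L₄ = (x,as,bs)`, `L₅ = (gs,y,bs)`, `L₆ = (gs,0,z)`, and it is the complete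
  intersection of the quadric `F_s = −b·xy + a·xz + g·yz − ag·s·z` (smooth for `abgs ≠ 0`) with the cubic
  `G_s = z(x − gs)(y − as)` (`petrie_line₁…₆`, `theta_translate_difference`, `petrie_quadric_smooth`);
* the COHERENT DOUBLE `W₀(c) = V(Q_c, xyz)` of TRIPLE-G28 6.5 / CONE-G29 §2 is the flat limit `s → 0` of these hexagons, with
  `[c₁₂ : c₁₃ : c₂₃] = [−b : a : g]` (`petrie_limit`), i.e. the POLAR CURVE `V(ϑ, ∂_w ϑ)` of `Θ` along `w = (c₂₃, c₁₃, c₁₂)`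
  (`polar_expansion`, `polar_dictionary`) = `lim_{ε→0} Θ ∩ Θ_{εw}`.
Consequences drawn in the account (not here): theta divisors and their polar curves move with `(X, Θ)` over all of `A₃`, so
THEOREM W (`L(W₀(c)) ⊇ Sym`, 6/6) and the hexagon's 6/6 hold without residue computations, Q28.7 is answered YES (the coherent
double deforms over the whole germ `(A₃, E³)`: an ANCHOR), and `Hilb_{θ²,χ=−6}(𝒳/A₃)` is smooth at `[W₀(c)]` iff `h⁰(N) = 6`.
Two counting lemmas used there are also recorded: the hexagon's embedded first-order deformations in `E³` are the solutions of
six independent node conditions on twelve translation parameters (`hexagon_normal_sections`, `h⁰(N_Hex) = 6`), and a theta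
translate `Θ_t` contains the hexagon `Θ_u ∩ Θ_v` iff `t ∈ {u, v}` (`theta_translates_through_hexagon`: the family of theta-pair
intersections is generically finite onto its image, hence 12-dimensional over `A₃`).

0 sorry, no `def`, no named fact; `HC_CM` does not occur.
-/

namespace Summit.HodgeConjecture.Ring2AbelianAll.NonsplitThetaPolar

/-- **Petrie hexagon, line `L₁ = (x, 0, 0)`** lies on the quadric `F_s` and on the cubic `G_s`.
research route, not a corollary; conditional on HC_CM plus one named minimal statement. [locator ANCHOR-G30 §2 LEMMA P] -/
theorem petrie_line₁ {K : Type*} [CommRing K] (a b g s x : K) :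
    -b * x * 0 + a * x * 0 + g * 0 * 0 - a * g * s * 0 = (0 : K) ∧ 0 * (x - g * s) * (0 - a * s) = (0 : K) := by
  constructor <;> ring

/-- **Petrie hexagon, line `L₂ = (0, y, 0)`**.
research route, not a corollary; conditional on HC_CM plus one named minimal statement. [locator ANCHOR-G30 §2 LEMMA P] -/
theorem petrie_line₂ {K : Type*} [CommRing K] (a b g s y : K) :
    -b * 0 * y + a * 0 * 0 + g * y * 0 - a * g * s * 0 = (0 : K) ∧ 0 * (0 - g * s) * (y - a * s) = (0 : K) := by
  constructor <;> ring

/-- **Petrie hexagon, line `L₃ = (0, as, z)`**.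
research route, not a corollary; conditional on HC_CM plus one named minimal statement. [locator ANCHOR-G30 §2 LEMMA P] -/
theorem petrie_line₃ {K : Type*} [CommRing K] (a b g s z : K) :
    -b * 0 * (a * s) + a * 0 * z + g * (a * s) * z - a * g * s * z = 0 ∧
      z * (0 - g * s) * (a * s - a * s) = 0 := by
  constructor <;> ring

/-- **Petrie hexagon, line `L₄ = (x, as, bs)`**.
research route, not a corollary; conditional on HC_CM plus one named minimal statement. [locator ANCHOR-G30 §2 LEMMA P] -/
theorem petrie_line₄ {K : Type*} [CommRing K] (a b g s x : K) :
    -b * x * (a * s) + a * x * (b * s) + g * (a * s) * (b * s) - a * g * s * (b * s) = 0 ∧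
      b * s * (x - g * s) * (a * s - a * s) = 0 := by
  constructor <;> ring

/-- **Petrie hexagon, line `L₅ = (gs, y, bs)`**.
research route, not a corollary; conditional on HC_CM plus one named minimal statement. [locator ANCHOR-G30 §2 LEMMA P] -/
theorem petrie_line₅ {K : Type*} [CommRing K] (a b g s y : K) :
    -b * (g * s) * y + a * (g * s) * (b * s) + g * y * (b * s) - a * g * s * (b * s) = 0 ∧
      b * s * (g * s - g * s) * (y - a * s) = 0 := by
  constructor <;> ring

/-- **Petrie hexagon, line `L₆ = (gs, 0, z)`**.
research route, not a corollary; conditional on HC_CM plus one named minimal statement. [locator ANCHOR-G30 §2 LEMMA P] -/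
theorem petrie_line₆ {K : Type*} [CommRing K] (a b g s z : K) :
    -b * (g * s) * 0 + a * (g * s) * z + g * 0 * z - a * g * s * z = 0 ∧
      z * (g * s - g * s) * (0 - a * s) = 0 := by
  constructor <;> ring

/-- **The two theta translates differ by `s` times the quadric.**  With `Θ_t = V((x − t₁)(y − t₂)(z − t₃))`,
`t = s(0,0,b)`, `t' = s(g,a,0)`: `ϑ_{t'} − ϑ_t = −s·F_s`; so `F_s ∈ ((ϑ_t, ϑ_{t'}) : s)` and the hexagon `Θ_t ∩ Θ_{t'}` lies
on the quadric `F_s` (the saturation step of LEMMA Θ / LEMMA P).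
research route, not a corollary; conditional on HC_CM plus one named minimal statement. [locator ANCHOR-G30 §2 LEMMA Θ] -/
theorem theta_translate_difference {K : Type*} [CommRing K] (a b g s x y z : K) :
    (x - g * s) * (y - a * s) * z - x * y * (z - b * s) =
      -s * (-b * x * y + a * x * z + g * y * z - a * g * s * z) := by
  ring

/-- **The Petrie quadric is smooth for `abgs ≠ 0`.**  No point satisfies `F_s = ∂_xF_s = ∂_yF_s = ∂_zF_s = 0`
(Euler: `x∂_x + y∂_y + z∂_z = 2F_s + ags·z`); so for `s ≠ 0` the hexagon is a curve of type `(3,3)` on a smooth quadric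
(alternate sides in the two rulings), degenerating at `s = 0` to the quadric CONE `Q_c ⊃ T`.
research route, not a corollary; conditional on HC_CM plus one named minimal statement. [locator ANCHOR-G30 §2 LEMMA P] -/
theorem petrie_quadric_smooth {K : Type*} [Field K] (a b g s : K) (ha : a ≠ 0) (hb : b ≠ 0) (hg : g ≠ 0)
    (hs : s ≠ 0) :
    ¬ ∃ x y z : K, -b * x * y + a * x * z + g * y * z - a * g * s * z = 0 ∧
        -b * y + a * z = 0 ∧ -b * x + g * z = 0 ∧ a * x + g * y - a * g * s = 0 := by
  rintro ⟨x, y, z, hF, h1, h2, h3⟩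
  have hz : a * g * s * z = 0 := by linear_combination x * h1 + y * h2 + z * h3 - 2 * hF
  have hz0 : z = 0 := by
    rcases mul_eq_zero.mp hz with h | h
    · rcases mul_eq_zero.mp h with h' | h'
      · rcases mul_eq_zero.mp h' with h'' | h''
        · exact absurd h'' ha
        · exact absurd h'' hg
      · exact absurd h' hs
    · exact h
  subst hz0
  have hy : y = 0 := by
    have : -b * y = 0 := by linear_combination h1
    rcases mul_eq_zero.mp this with h | h
    · exact absurd (neg_eq_zero.mp h) hb
    · exact h
  have hx : x = 0 := by
    have : -b * x = 0 := by linear_combination h2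
    rcases mul_eq_zero.mp this with h | h
    · exact absurd (neg_eq_zero.mp h) hb
    · exact h
  subst hy; subst hx
  have : a * g * s = 0 := by linear_combination -h3
  rcases mul_eq_zero.mp this with h | h
  · rcases mul_eq_zero.mp h with h' | h'
    · exact ha h'
    · exact hg h'
  · exact hs h

/-- **The flat limit of the Petrie hexagon.**  At `s = 0` the quadric `F_s` becomes `Q_c = c₁₂xy + c₁₃xz + c₂₃yz` with
`(c₁₂, c₁₃, c₂₃) = (−b, a, g)` and the cubic `G_s` becomes `xyz`: the complete intersection `V(Q_c, xyz) = W₀(c)`, the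
coherent double of TRIPLE-G28 6.5 (flatness: `V(Q_c, xyz)` is still a complete-intersection curve; machine ×1:
`code/g30/hexagon_limit.py`, `theta_pair_limit.py`).  Every `c` with `c₁₂c₁₃c₂₃ ≠ 0` arises (`a = c₁₃, b = −c₁₂, g = c₂₃`).
research route, not a corollary; conditional on HC_CM plus one named minimal statement. [locator ANCHOR-G30 §2 LEMMA P] -/
theorem petrie_limit {K : Type*} [CommRing K] (a b g x y z : K) :
    (-b * x * y + a * x * z + g * y * z - a * g * 0 * z = (-b) * (x * y) + a * (x * z) + g * (y * z)) ∧
      (z * (x - g * 0) * (y - a * 0) = x * y * z) := by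
  constructor <;> ring

/-- **Polar expansion of the theta function.**  `ϑ(p + εw) = ϑ(p) + ε·∂_wϑ(p) + O(ε²)` for `ϑ = xyz`:
`∂_wϑ = w₁yz + w₂xz + w₃xy`, so `lim_{ε→0} Θ ∩ Θ_{εw} = V(ϑ, ∂_wϑ)` has local ideal `(xyz, w₁yz + w₂xz + w₃xy)` at the triple
point.
research route, not a corollary; conditional on HC_CM plus one named minimal statement. [locator ANCHOR-G30 §2 LEMMA Θ] -/
theorem polar_expansion {K : Type*} [CommRing K] (w₁ w₂ w₃ ε x y z : K) :
    (x + ε * w₁) * (y + ε * w₂) * (z + ε * w₃) =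
      x * y * z + ε * (w₁ * (y * z) + w₂ * (x * z) + w₃ * (x * y)) +
        ε ^ 2 * (w₁ * w₂ * z + w₁ * w₃ * y + w₂ * w₃ * x) + ε ^ 3 * (w₁ * w₂ * w₃) := by
  ring

/-- **The dictionary `c ↔ w ↔ box`.**  The quadric of the coherent double `W₀(c)`, the polar quadric `∂_wϑ` with
`w = (c₂₃, c₁₃, c₁₂)`, and the limit Petrie quadric with box extents `(g, a, b) = (c₂₃, c₁₃, −c₁₂)` coincide:
`W₀(c) = V(ϑ, ∂_wϑ) = lim_s Θ_{s(0,0,b)} ∩ Θ_{s(g,a,0)}`.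
research route, not a corollary; conditional on HC_CM plus one named minimal statement. [locator ANCHOR-G30 §2 LEMMA Θ] -/
theorem polar_dictionary {K : Type*} [CommRing K] (c₁₂ c₁₃ c₂₃ x y z : K) :
    (c₂₃ * (y * z) + c₁₃ * (x * z) + c₁₂ * (x * y) = c₁₂ * (x * y) + c₁₃ * (x * z) + c₂₃ * (y * z)) ∧
      ((-(-c₁₂)) * (x * y) + c₁₃ * (x * z) + c₂₃ * (y * z) = c₁₂ * (x * y) + c₁₃ * (x * z) + c₂₃ * (y * z)) := by
  constructor <;> ring

/-- **`h⁰(N_Hex) = 6`: the node conditions.**  An embedded first-order deformation of the hexagon inside `E³` restricts on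
each of the six lines to a constant normal vector (no pole sections: `h⁰(O_E(p)) = 1`), i.e. twelve parameters
`(β₁,γ₁ | α₂,γ₂ | α₃,β₃ | β₄,γ₄ | α₅,γ₅ | α₆,β₆)` (line `L_k` displaced in its two normal coordinates), subject to one
coplanarity condition per node (`L₁L₂: γ₁ = γ₂`, `L₂L₃: α₂ = α₃`, `L₃L₄: β₃ = β₄`, `L₄L₅: γ₄ = γ₅`, `L₅L₆: α₅ = α₆`,
`L₆L₁: β₆ = β₁`).  The solution space is parametrised by six free parameters: `h⁰(N_Hex) = 12 − 6 = 6` (= 3 translations + 3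
shape moduli = the dimension of the family of hexagons in `E³`), as ANCHOR-G30 LEMMA N needs.
research route, not a corollary; conditional on HC_CM plus one named minimal statement. [locator ANCHOR-G30 §2 LEMMA N] -/
theorem hexagon_normal_sections {K : Type*} [CommRing K] (β₁ γ₁ α₂ γ₂ α₃ β₃ β₄ γ₄ α₅ γ₅ α₆ β₆ : K) :
    (γ₁ = γ₂ ∧ α₂ = α₃ ∧ β₃ = β₄ ∧ γ₄ = γ₅ ∧ α₅ = α₆ ∧ β₆ = β₁) ↔
      ∃ p₁ p₂ p₃ p₄ p₅ p₆ : K,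
        β₁ = p₁ ∧ γ₁ = p₂ ∧ α₂ = p₃ ∧ γ₂ = p₂ ∧ α₃ = p₃ ∧ β₃ = p₄ ∧
          β₄ = p₄ ∧ γ₄ = p₅ ∧ α₅ = p₆ ∧ γ₅ = p₅ ∧ α₆ = p₆ ∧ β₆ = p₁ := by
  constructor
  · rintro ⟨h₁, h₂, h₃, h₄, h₅, h₆⟩
    exact ⟨β₁, γ₁, α₂, β₃, γ₄, α₅, rfl, rfl, rfl, h₁.symm, h₂.symm, rfl, h₃.symm, rfl, rfl, h₄.symm, h₅.symm, h₆⟩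
  · rintro ⟨p₁, p₂, p₃, p₄, p₅, p₆, e₁, e₂, e₃, e₄, e₅, e₆, e₇, e₈, e₉, e₁₀, e₁₁, e₁₂⟩
    refine ⟨?_, ?_, ?_, ?_, ?_, ?_⟩
    · rw [e₂, e₄]
    · rw [e₃, e₅]
    · rw [e₆, e₇]
    · rw [e₈, e₁₀]
    · rw [e₉, e₁₁]
    · rw [e₁₂, e₁]

/-- **Theta translates through the hexagon.**  The line `ℓ_{ab} = {x_a = u_a, x_b = v_b}` of `Θ_u ∩ Θ_v` lies in
`Θ_t = ⋃_c {x_c = t_c}` iff `t_a = u_a ∨ t_b = v_b`; imposing this for the six ordered pairs `a ≠ b`, and assuming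
`u₁ ≠ v₁`, `u₂ ≠ v₂` (two of the three genericity conditions `u_a ≠ v_a` suffice), forces `t = u` or `t = v`.  So the map `(X, u, v) ↦ Θ_u ∩ Θ_v` is generically finite (2 : 1) onto its
image and the family of theta-pair intersections over `A₃` is 12-dimensional (ANCHOR-G30 THEOREM U, dimension count).
research route, not a corollary; conditional on HC_CM plus one named minimal statement. [locator ANCHOR-G30 §2 THEOREM U] -/
theorem theta_translates_through_hexagon {K : Type*} (u₁ u₂ u₃ v₁ v₂ v₃ t₁ t₂ t₃ : K)
    (h₁ : u₁ ≠ v₁) (h₂ : u₂ ≠ v₂) :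
    ((t₁ = u₁ ∨ t₂ = v₂) ∧ (t₂ = u₂ ∨ t₁ = v₁) ∧ (t₁ = u₁ ∨ t₃ = v₃) ∧
        (t₃ = u₃ ∨ t₁ = v₁) ∧ (t₂ = u₂ ∨ t₃ = v₃) ∧ (t₃ = u₃ ∨ t₂ = v₂)) ↔
      ((t₁ = u₁ ∧ t₂ = u₂ ∧ t₃ = u₃) ∨ (t₁ = v₁ ∧ t₂ = v₂ ∧ t₃ = v₃)) := by
  constructor
  · rintro ⟨c12, c21, c13, c31, c23, c32⟩
    by_cases ht : t₁ = u₁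
    · left
      have hv : t₁ ≠ v₁ := by rw [ht]; exact h₁
      refine ⟨ht, ?_, ?_⟩
      · rcases c21 with h | h
        · exact h
        · exact absurd h hv
      · rcases c31 with h | h
        · exact h
        · exact absurd h hv
    · right
      have e2 : t₂ = v₂ := by
        rcases c12 with h | h
        · exact absurd h ht
        · exact h
      have e3 : t₃ = v₃ := by
        rcases c13 with h | h
        · exact absurd h ht
        · exact h
      have hu2 : t₂ ≠ u₂ := by rw [e2]; exact Ne.symm h₂
      refine ⟨?_, e2, e3⟩
      rcases c21 with h | h
      · exact absurd h hu2
      · exact h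
  · rintro (⟨e1, e2, e3⟩ | ⟨e1, e2, e3⟩)
    · exact ⟨Or.inl e1, Or.inl e2, Or.inl e1, Or.inl e3, Or.inl e2, Or.inl e3⟩
    · exact ⟨Or.inr e2, Or.inr e1, Or.inr e3, Or.inr e1, Or.inr e3, Or.inr e2⟩

end Summit.HodgeConjecture.Ring2AbelianAll.NonsplitThetaPolar
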